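import Literature.NumberTheory.Automorphic.CarayolCompatibilityOfLocalGlobalProofs
import Literature.NumberTheory.Automorphic.GLnUnramifiedLFactorDivisibility
import Literature.NumberTheory.Automorphic.LocalComponentBJGenericProofs
import Literature.NumberTheory.Automorphic.LocalComponentBJSatakeProofs
import Literature.NumberTheory.Automorphic.SatakeParametersGLProofs
import Literature.NumberTheory.GaloisRepresentations.WeilDeligneRepFrobSemisimpleProofs
import HarnessLib

/-!
# Carayol's local deduction in rank `n`: `rec_v(π_v)` is unramified with the Satake characteristic
# polynomial, for EVERY local Langlands datum (unconditionally)

Topic `Literature/NumberTheory/Automorphic`; proof file (theorems only: no definition, no named fact, no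
instance).  Let `F` be a non-archimedean local field, `d` a local Langlands datum of `F`
(`LocalLanglandsDatum`: Harris–Taylor's `rec` with its six accepted clauses), `π_v` an irreducible smooth
`ψ`-generic representation of `GL_n(F)`, `2 ≤ n`, with Satake parameter `α` w.r.t. a uniformiser `ϖ`
(`IsSatakeParameter`).  We prove:

* `LocalLanglandsDatum.recGL_out_unramified_of_isSatakeParameter`,
  `LocalLanglandsDatum.recGL_unramified_of_isSatakeParameter` — every Frobenius-semisimple representative
  `A` of `d.recGL n ⟦π_v⟧` has `N = 0`, is trivial on inertia, and `char(A.ρ Φ) = ∏_{a ∈ α} (X - a)` at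
  every geometric Frobenius `Φ`;
* `LocalLanglandsDatum.recGL_unramified_of_hasSatakeParamAt` — the same for `π_v` a local component at
  `v` of a cuspidal automorphic `π` on `GL_n(𝔸_K)` with `HasSatakeParamAt v α` (genericity and the Satake
  dictionary of cuspidal local components are theorems of the tree).

This is the rank-`n` form of `WeilDeligneRep.unramified_of_hasFrobSemisimpleClass_recGL_of_isSatakeParameter`
(`CarayolCompatibilityOfLocalGlobalProofs`, `n = 2`), now UNCONDITIONAL for every `n`: clause (iii-L)
`lFactor_pairs` of `d` says that `P₀ = det(1 - TΦ | (A₀ ⊗ rec 1)^{I, N = 0})`, `A₀ := (d.recGL n ⟦π_v⟧).out`,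
is THE JPSS `L`-polynomial of the pair `(π_v, 1_{GL₁})`; by the `GL_n × GL₁` unramified divisibility
(`prod_one_sub_C_mul_X_eq_of_hasRSLFactor_of_natDegree_le_gl` of `GLnUnramifiedLFactorDivisibility`:
one spherical test vector, Shintani's formula; `deg P₀ ≤ n` by `natDegree_eulerFactor_le`)
`P₀ = ∏ (1 - a T)` of full degree `n` (all `a ≠ 0`), so `(ker N)^I = A₀ ⊗ rec(1)`
(`inertiaInvariantsKerN_eq_top_of_natDegree_eulerFactor_eq`, `N_eq_zero_and_inertia_trivial_of_tprod_eq_top`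
with `rec(1) ≅ (1 ∘ artin, 0)` by clause (ii)), `det(1 - TΦ₀ | A₀) = ∏ (1 - a T)`
(`eulerFactor_eq_reverse_charpoly_of_eq_top`, `charpoly_tprod_ρ_eq`), i.e. `char(A₀.ρ Φ₀) = ∏ (X - a)`
by reflection; this passes to the equivalent `A` and to every geometric Frobenius.  These theorems were
first landed summit-side (line `Sketch` of the Langlands crux `ReciprocityUpToIrreducibility`, leads c5/c6:
`…RecGLUnramified`, `…RecGLUnramifiedOfDvd`, `…UnramifiedMatchingGLn`) and are re-homed here so that
Literature files can use the rank-`n` deduction.  No definitions; std axioms.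

## References

* H. Carayol, Ann. Sci. ÉNS 19 (1986), Thm. (A). [CarayolASENS1986]
* M. Harris, R. Taylor, Ann. of Math. Stud. 151 (2001), Thm. A (ii), (v). [HarrisTaylorAMS2001]
* J. Tate, *Number theoretic background*, Corvallis 1979, (4.1.6). [TateCorvallis1979]
* H. Jacquet, J. A. Shalika, Amer. J. Math. 103 (1981), §2. [JacquetShalika1981]
-/

open scoped MatrixGroups Matrix NumberField Classical Polynomial
open Filter IsDedekindDomain Field Polynomial MeasureTheory
  Literature.NumberTheory.GaloisRepresentations

noncomputable section

namespace Literature.NumberTheory.Automorphic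

open Literature.NumberTheory.EllipticCurves.Hida2000Thm326 (exists_haar_measure_quotient_fin_one)

/-! ### Polynomial bookkeeping: `∏ (1 - a X)` versus `∏ (X - a)` -/

/-- `deg ∏_{a ∈ α} (1 - a X) ≤ card α` and `reflect (card α) ∏_{a ∈ α} (1 - a X) = ∏_{a ∈ α} (X - a)`.
[folklore] -/
theorem reflect_card_prod_one_sub_C_mul_X_gl (α : Multiset ℂ) :
    ((α.map fun a => (1 : ℂ[X]) - C a * X).prod).natDegree ≤ Multiset.card α ∧
      reflect (Multiset.card α) ((α.map fun a => (1 : ℂ[X]) - C a * X).prod) =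
        (α.map fun a => X - C a).prod := by
  -- adapted from `reflect_card_prod_one_sub_C_mul_X_recGLn` (summit-side, c5 stub H4)
  induction α using Multiset.induction_on with
  | empty => simp
  | cons a s ih =>
    obtain ⟨hdeg, hrefl⟩ := ih
    have h1 : ((1 : ℂ[X]) - C a * X).natDegree ≤ 1 :=
      (natDegree_sub_le _ _).trans (max_le (by simp) ((natDegree_C_mul_le a X).trans natDegree_X_le))
    simp only [Multiset.map_cons, Multiset.prod_cons, Multiset.card_cons]
    refine ⟨natDegree_mul_le.trans (by omega), ?_⟩
    rw [add_comm, reflect_mul _ _ h1 hdeg, hrefl, reflect_sub, reflect_one, pow_one, reflect_C_mul,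
      reflect_one_X, mul_one]

/-- `deg ∏_{a ∈ α} (1 - a X) = card α` when no `a` vanishes. [folklore] -/
theorem natDegree_prod_one_sub_C_mul_X_gl {α : Multiset ℂ} (h : ∀ a ∈ α, a ≠ 0) :
    ((α.map fun a => (1 : ℂ[X]) - C a * X).prod).natDegree = Multiset.card α := by
  induction α using Multiset.induction_on with
  | empty => simp
  | cons a s ih =>
    have ha : a ≠ 0 := h a (Multiset.mem_cons_self a s)
    have hs := ih fun b hb => h b (Multiset.mem_cons_of_mem hb)
    have h1 : ((1 : ℂ[X]) - C a * X).natDegree = 1 := by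
      rw [natDegree_sub_eq_right_of_natDegree_lt] <;> rw [natDegree_C_mul_X _ ha]
      simp
    have h1' : ((1 : ℂ[X]) - C a * X) ≠ 0 := fun h0 => by simpa using congrArg (eval 0) h0
    have hs' : (s.map fun a => (1 : ℂ[X]) - C a * X).prod ≠ 0 := fun h0 => by
      simpa [eval_multiset_prod] using congrArg (eval 0) h0
    simp only [Multiset.map_cons, Multiset.prod_cons, Multiset.card_cons]
    rw [natDegree_mul h1' hs', h1, hs, add_comm]

/-- A polynomial of degree `card α` whose reverse is `∏_{a ∈ α} (1 - a X)` is `∏_{a ∈ α} (X - a)`.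
[folklore] -/
theorem eq_prod_X_sub_C_of_reverse_eq_gl {p : ℂ[X]} {α : Multiset ℂ}
    (hdeg : p.natDegree = Multiset.card α)
    (hrev : p.reverse = (α.map fun a => (1 : ℂ[X]) - C a * X).prod) :
    p = (α.map fun a => X - C a).prod := by
  rw [← (reflect_card_prod_one_sub_C_mul_X_gl α).2, ← hrev, Polynomial.reverse, hdeg, reflect_reflect]

/-! ### Weil–Deligne bookkeeping: equivalence transfer and change of geometric Frobenius -/

section WD

variable {F : Type} [Field F] [ValuativeRel F] [TopologicalSpace F] [IsNonarchimedeanLocalField F]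
  {n : ℕ}

/-- If `r ≅ r'` and `r'` has `N = 0` and trivial inertia action, then so does `r`, and
`char(r.ρ w) = char(r'.ρ w)` for every `w ∈ W_F`. [cite: TateCorvallis1979, (4.1.2)–(4.1.6)] -/
theorem WeilDeligneRep.unramified_charpoly_of_isEquivalent_gl {r r' : WeilDeligneRep F ℂ (Fin n → ℂ)}
    (h : r.IsEquivalent r') (hN : r'.N = 0) (hρ : ∀ u ∈ WeilGroup.inertia F, r'.ρ u = 1) :
    r.N = 0 ∧ WeilGroup.IsUnramifiedRep r.ρ ∧
      ∀ w : WeilGroup F, (r.ρ w).charpoly = (r'.ρ w).charpoly := by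
  -- adapted from `wd_unramified_charpoly_of_isEquivalent_recGLn` (summit-side, c5 stub H4)
  obtain ⟨e'⟩ := h
  set φ' : (Fin n → ℂ) ≃ₗ[ℂ] (Fin n → ℂ) := e'.toRepEquiv.toLinearEquiv with hφ'
  have hφ'ρ : ∀ (u : WeilGroup F) (y : Fin n → ℂ), φ' (r.ρ u y) = r'.ρ u (φ' y) := fun u y => by
    rw [hφ', Representation.Equiv.toLinearEquiv_apply, Representation.Equiv.toLinearEquiv_apply]
    exact Representation.IntertwiningMap.isIntertwining _ _ e'.toRepEquiv.toIntertwiningMap u y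
  have hφ'N : ∀ y : Fin n → ℂ, φ' (r.N y) = r'.N (φ' y) := fun y => LinearMap.congr_fun e'.comm_N y
  refine ⟨?_, fun u hu => ?_, fun w => ?_⟩
  · refine LinearMap.ext fun y => φ'.injective ?_
    rw [hφ'N, hN, LinearMap.zero_apply, LinearMap.zero_apply, map_zero]
  · refine LinearMap.ext fun y => φ'.injective ?_
    rw [hφ'ρ, hρ u hu]
    rfl
  · have hconj : φ'.conj (r.ρ w) = r'.ρ w := by
      refine LinearMap.ext fun y => ?_
      simp only [LinearEquiv.conj_apply, LinearMap.comp_apply, LinearEquiv.coe_coe, hφ'ρ,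
        LinearEquiv.apply_symm_apply]
    rw [← hconj, LinearEquiv.charpoly_conj]

/-- An unramified representation of `W_F` takes the same value at any two elements of the same degree
(they differ by inertia). [cite: TateCorvallis1979, (1.4.1), (4.1.6)] -/
theorem WeilDeligneRep.apply_eq_of_isUnramifiedRep_of_deg_eq_gl {r : WeilDeligneRep F ℂ (Fin n → ℂ)}
    (hρ : WeilGroup.IsUnramifiedRep r.ρ) {Φ Φ' : WeilGroup F}
    (h : WeilGroup.deg Φ = WeilGroup.deg Φ') : r.ρ Φ = r.ρ Φ' := by
  have hmem : Φ * Φ'⁻¹ ∈ WeilGroup.inertia F := by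
    rw [← WeilGroup.deg_eq_zero_iff_mem_inertia IsFrobPow.mul_holds IsFrobPow.unique_holds,
      WeilGroup.deg_mul IsFrobPow.mul_holds IsFrobPow.unique_holds,
      WeilGroup.deg_inv IsFrobPow.mul_holds IsFrobPow.unique_holds, h, add_neg_cancel]
  calc r.ρ Φ = r.ρ (Φ * Φ'⁻¹ * Φ') := by rw [inv_mul_cancel_right]
    _ = r.ρ Φ' := by rw [map_mul, hρ _ hmem, one_mul]

end WD

/-! ### The local deduction at a spherical generic `π_v` of `GL_n(F)`, for every datum -/

namespace LocalLanglandsDatum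

variable {F : Type} [Field F] [ValuativeRel F] [TopologicalSpace F] [IsNonarchimedeanLocalField F]

/-- **The chosen representative of `rec(π_v)` is unramified with the Satake characteristic polynomial —
for EVERY local Langlands datum, unconditionally.**  Let `d` be a local Langlands datum of `F`, `π_v` an
irreducible smooth `ψ`-generic representation of `GL_n(F)` (`2 ≤ n`) with Satake parameter `α` w.r.t. the
uniformiser `ϖ`.  Then `A₀ := (d.recGL n ⟦π_v⟧).out` has `N = 0`, trivial inertia action, and
`char(A₀.ρ Φ₀) = ∏_{a ∈ α} (X - a)` at the chosen geometric Frobenius `Φ₀`: clause (iii-L) makes the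
Euler factor `P₀` of `A₀ ⊗ rec(1)` THE JPSS `L`-polynomial of `(π_v, 1)`, of degree `≤ n`, hence
`P₀ = ∏ (1 - a T)` by the unramified divisibility; `rec(1) ≅ (1 ∘ artin, 0)` (clause (ii)); full degree
gives `(ker N)^I = A₀ ⊗ rec(1)` and `det(1 - TΦ₀ | A₀) = ∏ (1 - a T)`.
[cite: HarrisTaylorAMS2001, Thm. A (ii), (v)] [cite: TateCorvallis1979, (4.1.6)] [cite: JacquetShalika1981, §2] -/
theorem recGL_out_unramified_of_isSatakeParameter (d : LocalLanglandsDatum F) {n : ℕ} (hn : 1 < n)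
    (πv : SmoothIrrep (GL (Fin n) F)) {ψ : AddChar F Circle} (hψ : ψ.IsContinuousNontrivial)
    (hgen : IsGeneric πv.ρ ψ) {ϖ : Fˣ} (hϖ : (ValuativeRel.valuation F).IsUniformizer (ϖ : F))
    {α : Multiset ℂ} (hα : IsSatakeParameter πv.ρ ϖ α) :
    ((d.recGL n (IrrClass.mk πv)).out.1).N = 0 ∧
      (∀ u ∈ WeilGroup.inertia F, ((d.recGL n (IrrClass.mk πv)).out.1).ρ u = 1) ∧
      (((d.recGL n (IrrClass.mk πv)).out.1).ρ (WeilDeligneRep.geomFrob F d.hex)).charpoly =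
        (α.map fun a => X - C a).prod := by
  -- adapted from `recGL_out_unramified_of_dvd_recGLn` (summit-side, c6 stub S7')
  classical
  haveI := πv.isIrreducible
  haveI hirr1 : (Representation.trivial ℂ (GL (Fin 1) F) ℂ).IsIrreducible :=
    isIrreducible_trivial_complex _
  have hadm1 : (Representation.trivial ℂ (GL (Fin 1) F) ℂ).IsAdmissible :=
    isAdmissible_trivial_complex _
  have hcard : Multiset.card α = n := hα.1
  have hne : ∀ a ∈ α, a ≠ 0 := fun a ha => IsSatakeParameter.forall_ne_zero_holds hϖ hα a ha
  -- an invariant measure on `GL₁(F) ⧸ U₁`, finite on compacts and positive on opens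
  letI : MeasurableSpace F := borel F
  haveI : BorelSpace F := ⟨rfl⟩
  letI : MeasurableSpace (GL (Fin 1) F ⧸ upperUnitriangular (Fin 1) F) := borel _
  haveI : BorelSpace (GL (Fin 1) F ⧸ upperUnitriangular (Fin 1) F) := ⟨rfl⟩
  obtain ⟨_, _, ν, hinv, hfin, hpos, -⟩ := exists_haar_measure_quotient_fin_one (F := F)
  haveI := hinv
  haveI := hfin
  haveI := hpos
  -- the trivial irreducible smooth representation of `GL₁(F)` on `ℂ`, generic for `ψ⁻¹`
  let π' : SmoothIrrep (GL (Fin 1) F) :=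
    { V := ℂ
      ρ := Representation.trivial ℂ (GL (Fin 1) F) ℂ
      isIrreducible := hirr1
      isSmooth := hadm1.isSmooth }
  have hgen' : IsGeneric π'.ρ ψ⁻¹ := isGeneric_of_fin_one _ _
  -- (iii-L): the Euler factor `P₀` of `A₀ ⊗ B₀` is a JPSS `L`-polynomial of `(π_v, 1)`
  set A₀ := (d.recGL n (IrrClass.mk πv)).out.1 with hA₀
  set B₀ := (d.recGL 1 (IrrClass.mk π')).out.1 with hB₀
  set P₀ : ℂ[X] := (A₀.tprod B₀).eulerFactor d.hn d.hex with hP₀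
  have hRS : HasRSLFactor hn πv.ρ π'.ρ ψ ν P₀ :=
    (d.isLocalLanglands.lFactor_pairs Nat.one_pos hn πv π' ψ hψ hgen hgen' ν P₀).mpr hP₀
  -- `deg P₀ ≤ dim (A₀ ⊗ B₀) = n`, so `P₀ = ∏ (1 - a T)` by the unramified divisibility
  have hfr : Module.finrank ℂ (TensorProduct ℂ (Fin n → ℂ) (Fin 1 → ℂ)) = n := by
    rw [Module.finrank_tensorProduct, Module.finrank_fin_fun, Module.finrank_fin_fun, mul_one]
  have hdegle : P₀.natDegree ≤ n :=
    (natDegree_eulerFactor_le _ d.hn d.hex).trans ((Submodule.finrank_le _).trans hfr.le)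
  have hPeq : P₀ = (α.map fun a => (1 : ℂ[X]) - C a * X).prod :=
    prod_one_sub_C_mul_X_eq_of_hasRSLFactor_of_natDegree_le_gl πv.ρ hn hψ hgen hϖ hα ν hRS hdegle
  have hDdeg : ((α.map fun a => (1 : ℂ[X]) - C a * X).prod).natDegree = n := by
    rw [natDegree_prod_one_sub_C_mul_X_gl hne, hcard]
  -- (ii): `B₀ ≅ (1 ∘ artin, 0)`, so `B₀.N = 0` and `B₀.ρ = 1`
  have hgl : B₀.IsEquivalent (WeilDeligneRep.ofQuasiChar d.hns d.artin 1) :=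
    d.isLocalLanglands.gl_one 1 π' fun g v => by simp [π']
  obtain ⟨e⟩ := hgl
  set φ : (Fin 1 → ℂ) ≃ₗ[ℂ] ℂ := e.toRepEquiv.toLinearEquiv with hφ
  have hφρ : ∀ (u : WeilGroup F) (y : Fin 1 → ℂ),
      φ (B₀.ρ u y) = (WeilDeligneRep.ofQuasiChar d.hns d.artin 1).ρ u (φ y) := fun u y => by
    rw [hφ, Representation.Equiv.toLinearEquiv_apply, Representation.Equiv.toLinearEquiv_apply]
    exact Representation.IntertwiningMap.isIntertwining _ _ e.toRepEquiv.toIntertwiningMap u y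
  have hφN : ∀ y : Fin 1 → ℂ, φ (B₀.N y) = (WeilDeligneRep.ofQuasiChar d.hns d.artin 1).N (φ y) :=
    fun y => LinearMap.congr_fun e.comm_N y
  have hBρ : ∀ (u : WeilGroup F) (y : Fin 1 → ℂ), B₀.ρ u y = y := by
    intro u y
    apply φ.injective
    rw [hφρ, WeilDeligneRep.ofQuasiChar_ρ_apply]
    simp
  have hBN : B₀.N = 0 := by
    refine LinearMap.ext fun y => φ.injective ?_
    rw [hφN, WeilDeligneRep.ofQuasiChar_N, LinearMap.zero_apply, LinearMap.zero_apply, map_zero]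
  -- the Euler factor has degree `n = dim (A₀ ⊗ B₀)`, so `(ker N)^I` is everything
  have hPdeg : P₀.natDegree = n := by rw [hPeq, hDdeg]
  have htop : (A₀.tprod B₀).inertiaInvariantsKerN = ⊤ :=
    inertiaInvariantsKerN_eq_top_of_natDegree_eulerFactor_eq _ d.hn d.hex (hPdeg.trans hfr.symm)
  obtain ⟨hAN, hAρ⟩ := N_eq_zero_and_inertia_trivial_of_tprod_eq_top A₀ B₀ hBN hBρ htop
  -- the Euler factor is the reversed characteristic polynomial of `A₀.ρ Φ₀`
  have hrev : (A₀.ρ (WeilDeligneRep.geomFrob F d.hex)).charpoly.reverse =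
      (α.map fun a => (1 : ℂ[X]) - C a * X).prod := by
    rw [← charpoly_tprod_ρ_eq A₀ B₀ hBρ (WeilDeligneRep.geomFrob F d.hex),
      ← eulerFactor_eq_reverse_charpoly_of_eq_top _ d.hn d.hex htop, ← hP₀, hPeq]
  refine ⟨hAN, hAρ, eq_prod_X_sub_C_of_reverse_eq_gl ?_ hrev⟩
  rw [LinearMap.charpoly_natDegree, Module.finrank_fin_fun, hcard]

/-- **Every Frobenius-semisimple representative of `rec(π_v)` is unramified with the Satake
characteristic polynomial at every geometric Frobenius — for EVERY local Langlands datum,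
unconditionally** (`2 ≤ n`; the `n = 2` case is
`WeilDeligneRep.unramified_of_hasFrobSemisimpleClass_recGL_of_isSatakeParameter`): for `A`
Frobenius-semisimple with `d.recGL n ⟦π_v⟧ = ⟦A⟧`, `A.N = 0`, `A.ρ` is trivial on inertia, and
`char(A.ρ Φ) = ∏_{a ∈ α} (X - a)` whenever `deg Φ = -1`. [cite: CarayolASENS1986, Thm. (A)]
[cite: HarrisTaylorAMS2001, Thm. A (ii), (v)] [cite: TateCorvallis1979, (4.1.6)] -/
theorem recGL_unramified_of_isSatakeParameter (d : LocalLanglandsDatum F) {n : ℕ} (hn : 1 < n)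
    (πv : SmoothIrrep (GL (Fin n) F)) {ψ : AddChar F Circle} (hψ : ψ.IsContinuousNontrivial)
    (hgen : IsGeneric πv.ρ ψ) {ϖ : Fˣ} (hϖ : (ValuativeRel.valuation F).IsUniformizer (ϖ : F))
    {α : Multiset ℂ} (hα : IsSatakeParameter πv.ρ ϖ α)
    (A : WeilDeligneRep F ℂ (Fin n → ℂ)) (hA : A.IsFrobSemisimple)
    (hrec : d.recGL n (IrrClass.mk πv) = Quotient.mk (frobSemisimpleWDSetoid F n) ⟨A, hA⟩) :
    A.N = 0 ∧ WeilGroup.IsUnramifiedRep A.ρ ∧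
      ∀ Φ : WeilGroup F, WeilGroup.deg Φ = -1 →
        (A.ρ Φ).charpoly = (α.map fun a => X - C a).prod := by
  obtain ⟨hAN, hAρ, hch⟩ := d.recGL_out_unramified_of_isSatakeParameter hn πv hψ hgen hϖ hα
  have hAA : ((d.recGL n (IrrClass.mk πv)).out.1).IsEquivalent A :=
    Quotient.exact ((Quotient.out_eq _).trans hrec)
  obtain ⟨hN, hur, hchar⟩ := WeilDeligneRep.unramified_charpoly_of_isEquivalent_gl hAA.symm hAN hAρ
  refine ⟨hN, hur, fun Φ hΦ => ?_⟩
  rw [WeilDeligneRep.apply_eq_of_isUnramifiedRep_of_deg_eq_gl hur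
      (hΦ.trans (WeilDeligneRep.deg_geomFrob d.hmul d.huniq d.hex).symm), hchar, hch]

/-- **The same for a local component of a cuspidal automorphic representation.**  For a cuspidal `π` on
`GL_n(𝔸_K)` (`2 ≤ n`) with Satake parameter `α` at `v`, a local component `π_v` of `π` at `v` and ANY
local Langlands datum `d` of `K_v`, every Frobenius-semisimple representative `A` of `d.recGL n ⟦π_v⟧` has
`N = 0`, is trivial on inertia, and `char(A.ρ Φ) = ∏_{a ∈ α} (X - a)` for every geometric Frobenius
`Φ`: `π_v` is generic (`CuspidalAutomorphicRepData.exists_isGeneric_of_hasLocalComponentAt`) and `α` is a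
Satake parameter of `π_v` w.r.t. `artin Φ₀` (`CuspidalAutomorphicRepData.isSatakeParameter_of_hasLocalComponentAt`).
[cite: CarayolASENS1986, Thm. (A)] [cite: HarrisTaylorAMS2001, Thm. A (ii), (v)] [cite: JacquetShalika1981, §2] -/
theorem recGL_unramified_of_hasSatakeParamAt {K : Type} [Field K] [NumberField K] {n : ℕ} (hn : 1 < n)
    (hcpt : isCompact_glFiniteIntegralLevel n K) (π : CuspidalAutomorphicRepData n K hcpt)
    (v : HeightOneSpectrum (𝓞 K)) (α : Multiset ℂ) (hαsat : π.1.HasSatakeParamAt v α)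
    (d : LocalLanglandsDatum (v.adicCompletion K)) (πv : SmoothIrrep (GL (Fin n) (v.adicCompletion K)))
    (hloc : π.1.HasLocalComponentAt v πv.ρ)
    (A : WeilDeligneRep (v.adicCompletion K) ℂ (Fin n → ℂ)) (hA : A.IsFrobSemisimple)
    (hrec : d.recGL n (IrrClass.mk πv) =
      Quotient.mk (frobSemisimpleWDSetoid (v.adicCompletion K) n) ⟨A, hA⟩) :
    A.N = 0 ∧ WeilGroup.IsUnramifiedRep A.ρ ∧
      ∀ Φ : WeilGroup (v.adicCompletion K), WeilGroup.deg Φ = -1 →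
        (A.ρ Φ).charpoly = (α.map fun a => X - C a).prod := by
  haveI : NeZero n := ⟨by omega⟩
  haveI := πv.isIrreducible
  obtain ⟨ψ, hψ, hgen⟩ := π.exists_isGeneric_of_hasLocalComponentAt v πv.ρ πv.isSmooth hloc
  have hϖ := d.artin.artin_frob (WeilDeligneRep.geomFrob _ d.hex)
    (WeilDeligneRep.deg_geomFrob d.hmul d.huniq d.hex)
  have hαv := π.isSatakeParameter_of_hasLocalComponentAt v πv.ρ πv.isSmooth hloc hαsat hϖ
  exact d.recGL_unramified_of_isSatakeParameter hn πv hψ hgen hϖ hαv A hA hrec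

end LocalLanglandsDatum

end Literature.NumberTheory.Automorphic

end
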